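import Mathlib
import Literature.GroupTheory.PermutationGroups.PrimitiveGroupOrderProofs
import HarnessLib

/-!
# Orders of primitive groups: the elementary envelope of Maróti's Corollary 1.2

Maróti 2002, Cor. 1.2 (`Maroti2002_cor12` in `PrimitiveGroupOrder.lean`): a primitive
`G ≤ S_n` not containing `A_n` has `|G| < 3^n`, and `|G| < 2^n` if `n > 24`. Maróti's proof
(author's version §3, pp. 8–9) rests on CFSG through his Theorem 1.1 (O'Nan–Scott + CFSG; the
trichotomy (i) `(A_m)^r ≤ G ≤ S_m wr S_r` in product action of `k`-set actions, (ii)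
`M₁₁, M₁₂, M₂₃, M₂₄`, (iii) `|G| ≤ n · ∏_{i<[log₂ n]} (n - 2^i)`): Lemma 3.2
(`|G| ≤ |M₁₂|^{n/12} < 3^n`: "If `n ≤ 9`, then Bochert's bound, while if `n ≥ 10`, then both
`n^{√n}` and `n^{1+[log₂ n]}` are smaller than `c^n`", `c = 95040^{1/12}`) and Lemma 3.3 (i)
(`|G| > 2^n ⟹ G` is `2`-transitive of degree `≤ 24`, from Cor. 1.4 — whose degrees `n ≥ 23`
come from Theorem 1.1 alone: "if `n ≥ 23`, then `n^{√n}` and `n · ∏ (n - 2^i)` are smaller than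
`2^{n-1}`"; the Dixon–Mortimer tables [8] enter only the explicit list in degree `≤ 22`, which
Cor. 1.2 does not need). So `Maroti2002_cor12_holds` is not provable in the tree today, and what
stands between the tree and it is exactly the order-level content of Theorem 1.1: the sibling
file `PrimitiveGroupOrderSqrtBound.lean` derives `Maroti2002_cor12` in EVERY degree from that
content taken as a hypothesis (`Maroti2002_cor12_of_thm11`, with Lemma 3.1's arithmetic proved in
`WreathProductOrderSqrtBound.lean`). This file (proofs only; no definitions, no new named facts —
D-0026) lands what Cor. 1.2 reduces to over the tree's existing FACTS:

* unconditionally, from the PROVED Bochert bound (`Bochert1889_index_holds` in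
  `PrimitiveGroupOrderProofs.lean`): its order form `card_mul_factorial_half_le`
  (`|G| · ⌊(n+1)/2⌋! ≤ n!`), `card_lt_three_pow_of_le_eleven` — Cor. 1.2 in degree `n ≤ 11`
  (`|G| ≤ n!/⌊(n+1)/2⌋! < 3^n`), Maróti's own small-degree step ("If `n ≤ 9`, then Bochert's
  bound") — and `card_le_four_pow_of_le_twentyone` — Praeger–Saxl's `|G| ≤ 4^n` in degree
  `n ≤ 21` (`n!/⌊(n+1)/2⌋! ≤ 4^n`), no CFSG;
* from the fact `Maroti2002_cor11ii` (`|G| < 50 · n^{√n}`, Maróti Cor. 1.1 (ii), CFSG):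
  `card_lt_three_pow_of_Maroti2002_cor11ii` — the whole `3^n` clause (`50 · n^{√n} < 3^n` iff
  `n ≥ 11`; below that the unconditional case above);
  `card_lt_two_pow_of_Maroti2002_cor11ii` — the `2^n` clause for `n ≥ 38` (`50 · n^{√n} < 2^n`
  iff `n ≥ 38`; at `n = 38` the margin is `0.4 %`);
* packaged: `Maroti2002_cor12_of_cor11ii_off_window` — Cor. 1.2 in every degree
  `n ∉ [25, 37]`, from `Maroti2002_cor11ii` alone;
* links to the Praeger–Saxl fact `PraegerSaxl1980_card_le` (`|G| ≤ 4^n`, which Cor. 1.2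
  "improves"): it follows from `Maroti2002_cor12`, and from `Maroti2002_cor11ii`.

What is NOT covered from the facts, and why: the `2^n` clause for `25 ≤ n ≤ 37`. There
`50 · n^{√n} > 2^n` and Bochert's `n!/⌊(n+1)/2⌋!` is far above `2^n`: the factor `50` of
Cor. 1.1 (ii) (the price of `M₂₄`) costs exactly this window. Maróti's proof closes these degrees
from Theorem 1.1 itself — case (iii) `n · ∏ (n - 2^i) < 2^{n-1}` and case (i) `n^{√n} < 2^{n-1}`
for `n ≥ 23`, case (ii) living in degree `≤ 24` — and so does `Maroti2002_cor12_of_thm11`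
(`PrimitiveGroupOrderSqrtBound.lean`) from Theorem 1.1 as a hypothesis. From the tree's two Maróti
FACTS alone the window is unreachable; no new named fact is minted for it here (D-0026).

Numerics: `50 · n^{√n} ≤ B` is certified by a rational bound `√n ≤ p/q` (`n q² ≤ p²`) plus the
exact integer inequality `50^q · n^p ≤ B^q` (`fifty_mul_rpow_sqrt_le`), discharged by `decide`
degree by degree for `11 ≤ n ≤ 24` and `38 ≤ n ≤ 63` (e.g. `n = 38`: `√38 ≤ 487/79`,
`50^79 · 38^487 ≤ 2^3002`), and in closed form beyond: with `k = ⌊√n⌋`,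
`n^{k+1} < (k+1)^{2k+2}` and `50 (k+1)^{2k+2} ≤ 3^{k²}` (`k ≥ 5`), `≤ 2^{k²}` (`k ≥ 8`), via
`m³ ≤ 3^m` and `m³ ≤ 2^m` (`m ≥ 10`).
-/

namespace Literature.GroupTheory.PermutationGroups

open Equiv Equiv.Perm MulAction

section Bochert

variable {n : ℕ} {G : Subgroup (Perm (Fin n))}

/-- A subgroup of `S_n` not containing `A_n` has index `> 2` (Mathlib's
`Equiv.Perm.alternatingGroup_le_of_index_le_two`, contraposed). [folklore] -/
theorem two_lt_index_of_not_alternatingGroup_le (hA : ¬ alternatingGroup (Fin n) ≤ G) :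
    2 < G.index := by
  by_contra h
  exact hA (alternatingGroup_le_of_index_le_two (not_lt.mp h))

/-- **Bochert's bound in order form**: a primitive `G ≤ S_n` not containing `A_n` satisfies
`|G| · ⌊(n+1)/2⌋! ≤ n!` (from `Bochert1889_index_holds` and `|G| · (S_n : G) = n!`).
[cite: Cameron1999, Exercise 4.22 (Bochert's bound)] -/
theorem card_mul_factorial_half_le (hG : IsPreprimitive G (Fin n))
    (hA : ¬ alternatingGroup (Fin n) ≤ G) :
    Nat.card G * ((n + 1) / 2).factorial ≤ n.factorial := by
  have hB := Bochert1889_index_holds n G hG (two_lt_index_of_not_alternatingGroup_le hA)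
  calc Nat.card G * ((n + 1) / 2).factorial ≤ Nat.card G * G.index := Nat.mul_le_mul_left _ hB
    _ = Nat.card (Perm (Fin n)) := G.card_mul_index
    _ = n.factorial := by rw [Nat.card_perm, Nat.card_eq_fintype_card, Fintype.card_fin]

/-- **Maróti 2002, Cor. 1.2 in degree `≤ 11`, unconditionally**: a primitive `G ≤ S_n`,
`n ≤ 11`, not containing `A_n` has `|G| < 3^n` — by Bochert, `|G| ≤ n!/⌊(n+1)/2⌋! < 3^n` for
`1 ≤ n ≤ 11` (and `n = 0` is vacuous; the inequality `n!/⌊(n+1)/2⌋! < 3^n` holds exactly for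
`1 ≤ n ≤ 11` and `n = 13`). This is the small-degree step of Maróti's proof of Lemma 3.2 ("If
`n ≤ 9`, then Bochert's bound"), no CFSG. [cite: Maroti2002, Lemma 3.2 (proof, small degree)] -/
theorem card_lt_three_pow_of_le_eleven (hn : n ≤ 11) (hG : IsPreprimitive G (Fin n))
    (hA : ¬ alternatingGroup (Fin n) ≤ G) : Nat.card G < 3 ^ n := by
  rcases Nat.eq_zero_or_pos n with rfl | hpos
  · -- `n = 0`: `S_0` is trivial, so `A_0 ≤ G` and the hypothesis is absurd
    exact absurd (fun g _ => by rw [Subsingleton.elim g 1]; exact G.one_mem) hA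
  have key : ∀ m, m ≤ 11 → 1 ≤ m → m.factorial < 3 ^ m * ((m + 1) / 2).factorial := by
    decide
  have h1 : Nat.card G * ((n + 1) / 2).factorial < 3 ^ n * ((n + 1) / 2).factorial :=
    (card_mul_factorial_half_le hG hA).trans_lt (key n hn hpos)
  exact Nat.lt_of_mul_lt_mul_right h1

/-- `card_lt_three_pow_of_le_eleven` in degree `≤ 10` (kept under this name for stability).
[cite: Maroti2002, Lemma 3.2 (proof, small degree)] -/
theorem card_lt_three_pow_of_le_ten (hn : n ≤ 10) (hG : IsPreprimitive G (Fin n))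
    (hA : ¬ alternatingGroup (Fin n) ≤ G) : Nat.card G < 3 ^ n :=
  card_lt_three_pow_of_le_eleven (by omega) hG hA

/-- **Praeger–Saxl's bound in degree `≤ 21`, unconditionally**: a primitive `G ≤ S_n`,
`n ≤ 21`, not containing `A_n` has `|G| ≤ 4^n` — by Bochert, `|G| ≤ n!/⌊(n+1)/2⌋! ≤ 4^n`
for `n ≤ 21` (the inequality `n!/⌊(n+1)/2⌋! ≤ 4^n` holds exactly for `n ≤ 21` and `n = 23`);
no CFSG and none of Praeger–Saxl's Sylow-subgroup machinery. The fact `PraegerSaxl1980_card_le`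
asserts this in every degree. [cite: Maroti2002, §1 (Bochert; Praeger–Saxl)] -/
theorem card_le_four_pow_of_le_twentyone (hn : n ≤ 21) (hG : IsPreprimitive G (Fin n))
    (hA : ¬ alternatingGroup (Fin n) ≤ G) : Nat.card G ≤ 4 ^ n := by
  have key : ∀ m, m ≤ 21 → m.factorial ≤ 4 ^ m * ((m + 1) / 2).factorial := by decide
  have h1 : Nat.card G * ((n + 1) / 2).factorial ≤ 4 ^ n * ((n + 1) / 2).factorial :=
    (card_mul_factorial_half_le hG hA).trans (key n hn)
  exact Nat.le_of_mul_le_mul_right h1 (Nat.factorial_pos _)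

end Bochert

section Numerics

/-- `m³ ≤ 3^m` for every natural `m`. [folklore] -/
theorem cube_le_three_pow : ∀ m : ℕ, m ^ 3 ≤ 3 ^ m
  | 0 => by norm_num
  | 1 => by norm_num
  | 2 => by norm_num
  | (m + 3) => by
      induction m with
      | zero => norm_num
      | succ m ih =>
        have hstep : (m + 4) ^ 3 ≤ 3 * (m + 3) ^ 3 := by
          have h0 : 0 ≤ m := Nat.zero_le m
          nlinarith [pow_nonneg h0 2, pow_nonneg h0 3]
        calc (m + 1 + 3) ^ 3 = (m + 4) ^ 3 := by ring_nf
          _ ≤ 3 * (m + 3) ^ 3 := hstep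
          _ ≤ 3 * 3 ^ (m + 3) := Nat.mul_le_mul_left 3 ih
          _ = 3 ^ (m + 1 + 3) := by ring_nf

/-- `m³ ≤ 2^m` for `m ≥ 10`. [folklore] -/
theorem cube_le_two_pow {m : ℕ} (hm : 10 ≤ m) : m ^ 3 ≤ 2 ^ m := by
  induction m, hm using Nat.le_induction with
  | base => norm_num
  | succ m hm ih =>
    have hstep : (m + 1) ^ 3 ≤ 2 * m ^ 3 := by nlinarith [pow_nonneg (Nat.zero_le m) 2]
    calc (m + 1) ^ 3 ≤ 2 * m ^ 3 := hstep
      _ ≤ 2 * 2 ^ m := Nat.mul_le_mul_left 2 ih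
      _ = 2 ^ (m + 1) := by ring

/-- `50 · (k+1)^{2k+2} ≤ 3^{k²}` for `k ≥ 5` (numerics for `k = 5, 6`; cubing and `m³ ≤ 3^m`
beyond). [folklore] -/
theorem fifty_mul_pow_le_three_pow_sq {k : ℕ} (hk : 5 ≤ k) :
    50 * (k + 1) ^ (2 * k + 2) ≤ 3 ^ (k ^ 2) := by
  rcases (show k = 5 ∨ k = 6 ∨ 7 ≤ k by omega) with rfl | rfl | hk7
  · norm_num
  · norm_num
  have hc : (k + 1) ^ 3 ≤ 3 ^ (k + 1) := cube_le_three_pow (k + 1)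
  rw [← Nat.pow_le_pow_iff_left (show 3 ≠ 0 by norm_num)]
  calc (50 * (k + 1) ^ (2 * k + 2)) ^ 3 = 50 ^ 3 * ((k + 1) ^ 3) ^ (2 * k + 2) := by
        rw [mul_pow, ← pow_mul, mul_comm (2 * k + 2) 3, pow_mul]
    _ ≤ 3 ^ 11 * (3 ^ (k + 1)) ^ (2 * k + 2) :=
        Nat.mul_le_mul (by norm_num) (Nat.pow_le_pow_left hc _)
    _ = 3 ^ (11 + (k + 1) * (2 * k + 2)) := by rw [← pow_mul, ← pow_add]
    _ ≤ 3 ^ (k ^ 2 * 3) := Nat.pow_le_pow_right (by norm_num) (by nlinarith)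
    _ = (3 ^ (k ^ 2)) ^ 3 := by rw [pow_mul]

/-- `50 · (k+1)^{2k+2} ≤ 2^{k²}` for `k ≥ 8` (numerics for `k = 8`; cubing and `m³ ≤ 2^m`
beyond). [folklore] -/
theorem fifty_mul_pow_le_two_pow_sq {k : ℕ} (hk : 8 ≤ k) :
    50 * (k + 1) ^ (2 * k + 2) ≤ 2 ^ (k ^ 2) := by
  rcases (show k = 8 ∨ 9 ≤ k by omega) with rfl | hk9
  · norm_num
  have hc : (k + 1) ^ 3 ≤ 2 ^ (k + 1) := cube_le_two_pow (by omega)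
  rw [← Nat.pow_le_pow_iff_left (show 3 ≠ 0 by norm_num)]
  calc (50 * (k + 1) ^ (2 * k + 2)) ^ 3 = 50 ^ 3 * ((k + 1) ^ 3) ^ (2 * k + 2) := by
        rw [mul_pow, ← pow_mul, mul_comm (2 * k + 2) 3, pow_mul]
    _ ≤ 2 ^ 17 * (2 ^ (k + 1)) ^ (2 * k + 2) :=
        Nat.mul_le_mul (by norm_num) (Nat.pow_le_pow_left hc _)
    _ = 2 ^ (17 + (k + 1) * (2 * k + 2)) := by rw [← pow_mul, ← pow_add]
    _ ≤ 2 ^ (k ^ 2 * 3) := Nat.pow_le_pow_right (by norm_num) (by nlinarith)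
    _ = (2 ^ (k ^ 2)) ^ 3 := by rw [pow_mul]

/-- `50 · n^{⌊√n⌋+1} ≤ 3^n` for `n ≥ 25` (`k = ⌊√n⌋ ≥ 5`, `n < (k+1)²`, `k² ≤ n`). [folklore] -/
theorem fifty_mul_pow_sqrt_succ_le_three_pow {n : ℕ} (hn : 25 ≤ n) :
    50 * n ^ (Nat.sqrt n + 1) ≤ 3 ^ n := by
  set k := Nat.sqrt n with hk
  have hk5 : 5 ≤ k := Nat.le_sqrt.mpr (le_trans (by norm_num) hn)
  have hlt : n < (k + 1) ^ 2 := Nat.lt_succ_sqrt' n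
  have hle : k ^ 2 ≤ n := Nat.sqrt_le' n
  calc 50 * n ^ (k + 1) ≤ 50 * ((k + 1) ^ 2) ^ (k + 1) :=
        Nat.mul_le_mul_left 50 (Nat.pow_le_pow_left hlt.le _)
    _ = 50 * (k + 1) ^ (2 * k + 2) := by rw [← pow_mul]; ring_nf
    _ ≤ 3 ^ (k ^ 2) := fifty_mul_pow_le_three_pow_sq hk5
    _ ≤ 3 ^ n := Nat.pow_le_pow_right (by norm_num) hle

/-- `50 · n^{⌊√n⌋+1} ≤ 2^n` for `n ≥ 64` (`k = ⌊√n⌋ ≥ 8`, `n < (k+1)²`, `k² ≤ n`). [folklore] -/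
theorem fifty_mul_pow_sqrt_succ_le_two_pow {n : ℕ} (hn : 64 ≤ n) :
    50 * n ^ (Nat.sqrt n + 1) ≤ 2 ^ n := by
  set k := Nat.sqrt n with hk
  have hk8 : 8 ≤ k := Nat.le_sqrt.mpr (le_trans (by norm_num) hn)
  have hlt : n < (k + 1) ^ 2 := Nat.lt_succ_sqrt' n
  have hle : k ^ 2 ≤ n := Nat.sqrt_le' n
  calc 50 * n ^ (k + 1) ≤ 50 * ((k + 1) ^ 2) ^ (k + 1) :=
        Nat.mul_le_mul_left 50 (Nat.pow_le_pow_left hlt.le _)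
    _ = 50 * (k + 1) ^ (2 * k + 2) := by rw [← pow_mul]; ring_nf
    _ ≤ 2 ^ (k ^ 2) := fifty_mul_pow_le_two_pow_sq hk8
    _ ≤ 2 ^ n := Nat.pow_le_pow_right (by norm_num) hle

/-- **Numeric engine.** From a rational upper bound `√n ≤ p/q` (i.e. `n q² ≤ p²`) and an exact
integer certificate `50^q · n^p ≤ B^q`, conclude `50 · n^{√n} ≤ B` over `ℝ` (monotonicity of
`t ↦ n^t` for `n ≥ 1`, then `q`-th powers). [folklore] -/
theorem fifty_mul_rpow_sqrt_le {n p q B : ℕ} (hq : 0 < q) (hn : 1 ≤ n) (hpq : n * q ^ 2 ≤ p ^ 2)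
    (hnum : 50 ^ q * n ^ p ≤ B ^ q) : (50 : ℝ) * (n : ℝ) ^ Real.sqrt n ≤ B := by
  have hq' : (q : ℝ) ≠ 0 := by positivity
  have h1 : (n : ℝ) ≤ ((p : ℝ) / q) ^ 2 := by
    rw [div_pow, le_div_iff₀ (by positivity)]
    exact_mod_cast hpq
  have hsqrt : Real.sqrt n ≤ (p : ℝ) / q :=
    calc Real.sqrt n ≤ Real.sqrt (((p : ℝ) / q) ^ 2) := Real.sqrt_le_sqrt h1
      _ = (p : ℝ) / q := Real.sqrt_sq (by positivity)
  have h2 : (n : ℝ) ^ Real.sqrt n ≤ (n : ℝ) ^ ((p : ℝ) / q) :=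
    Real.rpow_le_rpow_of_exponent_le (by exact_mod_cast hn) hsqrt
  have h3 : (50 : ℝ) * (n : ℝ) ^ ((p : ℝ) / q) ≤ B := by
    rw [← pow_le_pow_iff_left₀ (by positivity) (by positivity) hq.ne']
    calc ((50 : ℝ) * (n : ℝ) ^ ((p : ℝ) / q)) ^ q = (50 : ℝ) ^ q * (n : ℝ) ^ p := by
          rw [mul_pow, ← Real.rpow_natCast ((n : ℝ) ^ ((p : ℝ) / q)) q,
            ← Real.rpow_mul (by positivity), div_mul_cancel₀ _ hq', Real.rpow_natCast]
      _ ≤ (B : ℝ) ^ q := by exact_mod_cast hnum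
  calc (50 : ℝ) * (n : ℝ) ^ Real.sqrt n ≤ 50 * (n : ℝ) ^ ((p : ℝ) / q) := by gcongr
    _ ≤ B := h3

end Numerics

variable {n : ℕ} {G : Subgroup (Perm (Fin n))}

/-- One instance of the fact `Maroti2002_cor11ii` (`|G| < 50 · n^{√n}`) turned into an integer
bound `|G| < B` by a certificate `√n ≤ p/q`, `50^q n^p ≤ B^q`. [cite: Maroti2002, Cor. 1.1 (ii)] -/
theorem card_lt_of_Maroti2002_cor11ii (h : Maroti2002_cor11ii) (hG : IsPreprimitive G (Fin n))
    (hA : ¬ alternatingGroup (Fin n) ≤ G) {p q B : ℕ} (hq : 0 < q) (hn : 1 ≤ n)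
    (hpq : n * q ^ 2 ≤ p ^ 2) (hnum : 50 ^ q * n ^ p ≤ B ^ q) : Nat.card G < B := by
  have h1 := (h n G hG hA).trans_le (fifty_mul_rpow_sqrt_le hq hn hpq hnum)
  exact_mod_cast h1

/-- **Maróti 2002, Cor. 1.2, the `3^n` clause, from Cor. 1.1 (ii).** For a primitive
`G ≤ S_n` not containing `A_n`: `|G| < 3^n` — for `n ≤ 10` unconditionally (Bochert,
`card_lt_three_pow_of_le_ten`), for `n ≥ 11` from `|G| < 50 · n^{√n} ≤ 3^n` (certificates
`√11 ≤ 10/3`, `√12 ≤ 7/2`, `√n ≤ 4 (n ≤ 16)`, `√n ≤ 5 (n ≤ 24)`, closed form from `n = 25`).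
Mirrors Maróti's Lemma 3.2 ("If `n ≤ 9`, then Bochert's bound, while if `n ≥ 10` …") with
Cor. 1.1 (ii) in place of Theorem 1.1. [cite: Maroti2002, Cor. 1.2 and Lemma 3.2] -/
theorem card_lt_three_pow_of_Maroti2002_cor11ii (h : Maroti2002_cor11ii) (n : ℕ)
    (G : Subgroup (Perm (Fin n))) (hG : IsPreprimitive G (Fin n))
    (hA : ¬ alternatingGroup (Fin n) ≤ G) : Nat.card G < 3 ^ n := by
  rcases Nat.lt_or_ge n 11 with h10 | h11
  · -- `n ≤ 10`: Bochert (unconditional; `card_lt_three_pow_of_le_eleven` covers `n ≤ 11`)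
    exact card_lt_three_pow_of_le_eleven (by omega) hG hA
  rcases Nat.lt_or_ge n 25 with h24 | h25
  · interval_cases n
    all_goals first
      | (refine card_lt_of_Maroti2002_cor11ii h hG hA (p := 4) (q := 1) one_pos ?_ ?_ ?_
          <;> decide)
      | (refine card_lt_of_Maroti2002_cor11ii h hG hA (p := 5) (q := 1) one_pos ?_ ?_ ?_
          <;> decide)
      | (refine card_lt_of_Maroti2002_cor11ii h hG hA (p := 7) (q := 2) two_pos ?_ ?_ ?_
          <;> decide)
      | (refine card_lt_of_Maroti2002_cor11ii h hG hA (p := 10) (q := 3) three_pos ?_ ?_ ?_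
          <;> decide)
  · exact card_lt_of_Maroti2002_cor11ii h hG hA (p := Nat.sqrt n + 1) (q := 1) one_pos (by omega)
      (by simpa using (Nat.lt_succ_sqrt' n).le)
      (by simpa using fifty_mul_pow_sqrt_succ_le_three_pow h25)

/-- **Maróti 2002, Cor. 1.2, the `2^n` clause in degree `n ≥ 38`, from Cor. 1.1 (ii).** For a
primitive `G ≤ S_n`, `n ≥ 38`, not containing `A_n`: `|G| < 2^n`, from
`|G| < 50 · n^{√n} ≤ 2^n` (false for `n ≤ 37`; certificates `√38 ≤ 487/79`, `√39 ≤ 25/4`,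
`√40 ≤ 32/5`, `√41, √42 ≤ 13/2`, `√43 ≤ 27/4`, `√n ≤ 7 (n ≤ 49)`, `√n ≤ 15/2 (n ≤ 56)`,
`√n ≤ 8 (n ≤ 63)`, closed form from `n = 64`). The degrees `25 ≤ n ≤ 37` of the printed
clause (`n > 24`) are NOT reachable this way (Maróti reaches them from Theorem 1.1 itself,
Lemma 3.3 (i) / Cor. 1.4 for `n ≥ 23`; cf. `card_lt_two_pow_of_trichotomy` in
`PrimitiveGroupOrderSqrtBound.lean`). [cite: Maroti2002, Cor. 1.2 and Lemma 3.3 (i)] -/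
theorem card_lt_two_pow_of_Maroti2002_cor11ii (h : Maroti2002_cor11ii) (n : ℕ) (hn : 38 ≤ n)
    (G : Subgroup (Perm (Fin n))) (hG : IsPreprimitive G (Fin n))
    (hA : ¬ alternatingGroup (Fin n) ≤ G) : Nat.card G < 2 ^ n := by
  rcases Nat.lt_or_ge n 64 with h63 | h64
  · interval_cases n
    · -- `n = 38`: `√38 ≤ 487/79` and `50^79 · 38^487 ≤ 2^3002` (margin ≈ 1.3)
      exact card_lt_of_Maroti2002_cor11ii h hG hA (p := 487) (q := 79) (by norm_num) (by norm_num)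
        (by norm_num) (by decide +kernel)
    all_goals first
      | (refine card_lt_of_Maroti2002_cor11ii h hG hA (p := 7) (q := 1) one_pos ?_ ?_ ?_
          <;> decide)
      | (refine card_lt_of_Maroti2002_cor11ii h hG hA (p := 8) (q := 1) one_pos ?_ ?_ ?_
          <;> decide)
      | (refine card_lt_of_Maroti2002_cor11ii h hG hA (p := 15) (q := 2) two_pos ?_ ?_ ?_
          <;> decide)
      | (refine card_lt_of_Maroti2002_cor11ii h hG hA (p := 13) (q := 2) two_pos ?_ ?_ ?_
          <;> decide)
      | (refine card_lt_of_Maroti2002_cor11ii h hG hA (p := 25) (q := 4) four_pos ?_ ?_ ?_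
          <;> decide)
      | (refine card_lt_of_Maroti2002_cor11ii h hG hA (p := 27) (q := 4) four_pos ?_ ?_ ?_
          <;> decide)
      | (refine card_lt_of_Maroti2002_cor11ii h hG hA (p := 32) (q := 5) (by norm_num)
          ?_ ?_ ?_ <;> decide)
  · exact card_lt_of_Maroti2002_cor11ii h hG hA (p := Nat.sqrt n + 1) (q := 1) one_pos (by omega)
      (by simpa using (Nat.lt_succ_sqrt' n).le)
      (by simpa using fifty_mul_pow_sqrt_succ_le_two_pow h64)

/-- **Maróti 2002, Cor. 1.2 off the window `25 ≤ n ≤ 37`, from Cor. 1.1 (ii).** For every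
degree `n ≤ 24` or `n ≥ 38`, the statement of `Maroti2002_cor12` in degree `n` follows from the
fact `Maroti2002_cor11ii` (and the proved Bochert bound): `|G| < 3^n`, and `|G| < 2^n` when
`24 < n`. The complementary window needs Theorem 1.1 itself rather than Cor. 1.1 (ii)
(`Maroti2002_cor12_of_thm11`, `PrimitiveGroupOrderSqrtBound.lean`). [cite: Maroti2002, Cor. 1.2] -/
theorem Maroti2002_cor12_of_cor11ii_off_window (h : Maroti2002_cor11ii) (n : ℕ)
    (hn : n ≤ 24 ∨ 38 ≤ n) (G : Subgroup (Perm (Fin n))) (hG : IsPreprimitive G (Fin n))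
    (hA : ¬ alternatingGroup (Fin n) ≤ G) :
    Nat.card G < 3 ^ n ∧ (24 < n → Nat.card G < 2 ^ n) :=
  ⟨card_lt_three_pow_of_Maroti2002_cor11ii h n G hG hA, fun h24 =>
    card_lt_two_pow_of_Maroti2002_cor11ii h n (by omega) G hG hA⟩

section PraegerSaxl

/-- **Cor. 1.2 improves Praeger–Saxl** ("This improves the Praeger-Saxl [16] theorem", Maróti
2002, after Cor. 1.2): the fact `Maroti2002_cor12` (`|G| < 3^n`) implies the fact
`PraegerSaxl1980_card_le` (`|G| ≤ 4^n`), since `3^n ≤ 4^n`. [cite: Maroti2002, Cor. 1.2] -/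
theorem PraegerSaxl1980_card_le_of_Maroti2002_cor12 (h : Maroti2002_cor12) :
    PraegerSaxl1980_card_le := fun n G hG hA =>
  ((h n G hG hA).1.trans_le (Nat.pow_le_pow_left (by norm_num) n)).le

/-- Praeger–Saxl's `|G| ≤ 4^n` in every degree, from the fact `Maroti2002_cor11ii` (the `3^n`
clause of Cor. 1.2 holds in all degrees given Cor. 1.1 (ii)). [cite: Maroti2002, Cor. 1.2] -/
theorem PraegerSaxl1980_card_le_of_Maroti2002_cor11ii (h : Maroti2002_cor11ii) :
    PraegerSaxl1980_card_le := fun n G hG hA =>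
  ((card_lt_three_pow_of_Maroti2002_cor11ii h n G hG hA).trans_le
    (Nat.pow_le_pow_left (by norm_num) n)).le

end PraegerSaxl

end Literature.GroupTheory.PermutationGroups
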